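import Mathlib
import Summits.NavierStokesRegularity.NavierStokesRegularity.Theorems.EulerZoomLiouvillePowerGaugeEulerLiouvilleSelfSimilarEndpointMemberFull
import HarnessLib

/-!
# Rung C1 of the crux `EulerZoomLiouville.PowerGaugeEulerLiouville` at the endpoint `ρ = 1/2` (weak class):
# the energy drain at member level, and the SHELL-SPREAD widening of the power-spread stratum

Route №10 `EulerZoomLiouville` (NavierStokesRegularity), crux E = stmt-NavierStokesRegularity-19832,
registered open stub `stub_selfSimilarWeakRest`; its binder `¬ (ρ = 1/2 ∧ IsPowerSpreadProfile V)`
records the filled endpoint stratum (`selfSimilar_half_ae_eq_zero_of_powerSpread'`: Chae–Shvydkoy's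
Thm 3.1 in Seregin's class — POINTWISE two-sided spread `c₀|y|^{−(4−δ')} ≤ ‖V(y)‖ ≤ C_up|y|^{1−δ}`
a.e. far out).  The tree's proof uses the lower POINTWISE bound only at the very end, through the lower
SHELL-ENERGY bound it implies (`shell_energy_lower_of_powerLower`), against the energy drain
`∫_{L≤|y|<2L}‖V‖² ≤ C_ε L^{−5+ε}` (`shell_energy_decay_half`).  This file exports the drain at MEMBER
level and replaces the pointwise lower bound by a lower bound on the dyadic SHELL ENERGIES along an
unbounded set of radii:

* `EndpointSpread.shell_energy_decay_of_sublinear` — crux hypotheses verbatim at `ρ = 1/2` + exact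
  self-similarity + sublinear growth `‖V(y)‖ ≤ C_up|y|^{1−δ}` a.e. far out ⇒ for every `ε > 0`,
  `∫_{L≤|y|<2L} ‖V‖² ≤ C_ε L^{−5+ε}` for all `L ≥ 1` (the member-level energy drain; every profile-side
  input — `V ∈ L² ∩ L³_loc`, `|P||V| ∈ L¹_loc`, the forward profile LEI, the Riesz representation of
  `P` at every scale — is derived from the class as in `…SelfSimilarEndpointMemberFull`);
* `EndpointSpread.selfSimilar_half_false_of_shellLower` — if moreover, for some `c₀, η > 0`, the
  shell energy is `≥ c₀ L^{−5+η}` for radii `L` BEYOND EVERY BOUND (not necessarily all large `L`),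
  contradiction; `…ae_eq_zero_of_shellLower` is the `Sig`-shaped form.  This is strictly weaker than
  the power spread: a pointwise lower bound `c₀|y|^{−(4−δ')}` a.e. on `|y| ≥ R₀'` gives the shell bound
  with `η = 2 min(δ',4)` at ALL `L ≥ max R₀' 1` (`EndpointSpread.shellLower_of_powerLower`), while e.g.
  a tail `|y|^{−β} W(y/|y|)` with `W` vanishing on an open set of directions (`3/2 < β < 4`) has the
  shell bound and no pointwise one (the tree's `selfSimilar_half_ae_eq_zero_of_powerSpread'` is thus the
  special case `hlow := shellLower_of_powerLower …` of `…ae_eq_zero_of_shellLower`).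

So at the endpoint the registered weak residue shrinks to: sublinear profiles whose dyadic shell
energies are eventually `≤ c₀ L^{−5+η}` for EVERY `c₀, η > 0` (super-drained profiles, including the
compactly supported ones — the open second half of CS13 Thm 4.2 (iii) in the weak class), and
profiles without sublinear pointwise growth.

WHAT THIS IS NOT: not NS, not E, not the stub — a widening of one filled endpoint stratum inside the
weak class; the endpoint WITHOUT any lower bound stays the open Chae–Shvydkoy endpoint.
[cite: ChaeShvydkoy2013, §3.1 Thm. 3.1; BronziShvydkoy2015, Remark 1.5]
-/

noncomputable section

-- flat `Theorems/<Route><Decl>…` files of one crux share the namespace of the crux (tree convention)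
set_option linter.dupNamespace false

open MeasureTheory Set Filter Topology Metric Function TopologicalSpace
open scoped ENNReal NNReal InnerProductSpace RealInnerProductSpace

namespace Summit.NavierStokesRegularity.NavierStokesRegularity.Theorems.PowerGaugeEulerLiouville

open Literature.Analysis Literature.Analysis.FunctionSpaces Literature.Analysis.FluidPDE

namespace EndpointSpread

section Drain

/-- **The energy drain of endpoint members with sublinear profiles (member level).**  Let
`(u, p, H, c)` satisfy the three hypotheses of the crux `PowerGaugeEulerLiouville` at `ρ = 1/2` and be
exactly self-similar (`γ = 2/5`) with profile `(V, P)`.  If `‖V(y)‖ ≤ C_up|y|^{1−δ}` a.e. for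
`|y| ≥ R₀` (`0 < δ ≤ 1`), then for every `ε > 0` there is `C` with
`∫_{L ≤ |y| < 2L} ‖V‖² ≤ C L^{−5+ε}` for all `L ≥ 1`.  All profile-side inputs of
`shell_energy_decay_half` are derived from the class (`A`-gauge ⇒ `V ∈ L²`; `|u|³ ∈ L¹_loc` ⇒
`V ∈ L³_loc`; weighted `D`-gauge ⇒ `|P||V| ∈ L¹_loc` and `∫_{B_L}|P| ≲ L^{5/3}`; the class LEI ⇒ the
forward profile LEI; the weak Poisson equation + growth ⇒ the Riesz representation at every scale).
[cite: ChaeShvydkoy2013, §3.1 proof of Thm. 3.1; BronziShvydkoy2015, Remark 1.5] -/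
theorem shell_energy_decay_of_sublinear
    {u : ℝ → EuclideanSpace ℝ (Fin 3) → EuclideanSpace ℝ (Fin 3)}
    {p : ℝ → EuclideanSpace ℝ (Fin 3) → ℝ}
    {H : ℝ → EuclideanSpace ℝ (Fin 3) → EuclideanSpace ℝ (Fin 3) →L[ℝ] EuclideanSpace ℝ (Fin 3)}
    {c : ℝ≥0} {V : EuclideanSpace ℝ (Fin 3) → EuclideanSpace ℝ (Fin 3)}
    {P : EuclideanSpace ℝ (Fin 3) → ℝ}
    (hsw : IsSuitableWeakSolutionOn (slab (EuclideanSpace ℝ (Fin 3)) (Iio 0) isOpen_Iio) 0 0 u p)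
    (hH : HasWeakSpatialGradientOn (slab (EuclideanSpace ℝ (Fin 3)) (Iio 0) isOpen_Iio) u H)
    (hgauge : ∀ a : ℝ, 0 < a →
      ENNReal.ofReal (a ^ (2 * (1 / 2 : ℝ))) * cknA a (0 : ℝ × EuclideanSpace ℝ (Fin 3)) u +
          ENNReal.ofReal (a ^ (1 / 2 : ℝ)) * cknE a (0 : ℝ × EuclideanSpace ℝ (Fin 3)) H +
        ENNReal.ofReal (a ^ (2 * (1 / 2 : ℝ))) * cknD a (0 : ℝ × EuclideanSpace ℝ (Fin 3)) p ≤
          (c : ℝ≥0∞))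
    (hu : ∀ τ : ℝ, τ < 0 → u τ = selfSimilarCollapse (1 / (2 + (1 / 2 : ℝ))) 0 V τ)
    (hp : ∀ τ : ℝ, τ < 0 → p τ = selfSimilarCollapsePressure (1 / (2 + (1 / 2 : ℝ))) 0 P τ)
    {δ Cup R₀ : ℝ} (hδ : 0 < δ) (hδ1 : δ ≤ 1) (hCup : 0 ≤ Cup)
    (hup : ∀ᵐ y ∂volume, R₀ ≤ ‖y‖ → ‖V y‖ ≤ Cup * ‖y‖ ^ (1 - δ))
    {ε : ℝ} (hε : 0 < ε) :
    ∃ C : ℝ, ∀ L : ℝ, 1 ≤ L →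
      ∫ y in {y : EuclideanSpace ℝ (Fin 3) | L ≤ ‖y‖ ∧ ‖y‖ < 2 * L}, ‖V y‖ ^ 2 ≤
        C * L ^ (-(5 : ℝ) + ε) := by
  -- adapted from `selfSimilar_half_false_of_powerSpread'` / `…_of_powerSpread` (same derivations,
  -- the lower bound removed)
  have hA : ∀ a : ℝ, 0 < a → ENNReal.ofReal (a ^ (2 * (1 / 2 : ℝ))) *
      cknA a (0 : ℝ × EuclideanSpace ℝ (Fin 3)) u ≤ (c : ℝ≥0∞) :=
    fun a ha => le_trans (le_trans le_self_add le_self_add) (hgauge a ha)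
  have hD : ∀ a : ℝ, 0 < a → ENNReal.ofReal (a ^ (2 * (1 / 2 : ℝ))) *
      cknD a (0 : ℝ × EuclideanSpace ℝ (Fin 3)) p ≤ (c : ℝ≥0∞) :=
    fun a ha => le_trans le_add_self (hgauge a ha)
  have hum : AEStronglyMeasurable (uncurry u)
      (volume.restrict (Iio (0 : ℝ) ×ˢ (univ : Set (EuclideanSpace ℝ (Fin 3))))) := by
    have := hH.locallyIntegrableOn.aestronglyMeasurable
    simpa [slab] using this
  have hpm : AEStronglyMeasurable (uncurry p)
      (volume.restrict (Iio (0 : ℝ) ×ˢ (univ : Set (EuclideanSpace ℝ (Fin 3))))) := by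
    have := hsw.distributional.2.2.1.aestronglyMeasurable
    simpa [slab] using this
  have hVm := aestronglyMeasurable_profile hum hu
  have hPm := aestronglyMeasurable_pressureProfile hpm hp
  -- `V ∈ L²` (endpoint `A`-gauge), `V ∈ L³_loc`
  have hV2 : Integrable (fun y => ‖V y‖ ^ 2) volume :=
    integrable_norm_sq_of_lintegral_lt_top hVm
      (lt_of_le_of_lt (lintegral_enorm_sq_profile_le_of_half hu hA) ENNReal.coe_lt_top)
  have hV3 : LocallyIntegrable (fun y => ‖V y‖ ^ 3) volume := locallyIntegrable_cube_profile hsw hum hu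
  -- `|P||V| ∈ L¹_loc` (weighted `D`-gauge bound)
  have hPw := profile_pressure_weight_of_gaugeD (ρ := 1 / 2) (by norm_num) (by norm_num) hpm hp hD
  have hBne : ENNReal.ofReal ((2 - 2 * (1 / 2 : ℝ)) / (2 + 1 / 2)) * (c : ℝ≥0∞) ≠ ⊤ :=
    ENNReal.mul_ne_top ENNReal.ofReal_ne_top ENNReal.coe_ne_top
  have hPV : LocallyIntegrable (fun y => |P y| * ‖V y‖) volume :=
    locallyIntegrable_abs_mul_norm_of_weight hPm hVm hV3 hBne hPw
  -- the forward profile LEI of the class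
  have hLEI := fun (σ : EuclideanSpace ℝ (Fin 3) → ℝ) (hσ : ContDiff ℝ (⊤ : ℕ∞) σ)
      (hσc : HasCompactSupport σ) (hσ0 : ∀ x, 0 ≤ σ x) =>
    selfSimilar_profile_energy_le_add_flux hsw hu hp hσ hσc hσ0
  -- `P ∈ L¹_loc`
  have hP1 : LocallyIntegrable P volume := by
    rw [locallyIntegrable_iff]
    intro K hK
    obtain ⟨r, hKr⟩ := hK.isBounded.subset_closedBall (0 : EuclideanSpace ℝ (Fin 3))
    have hr : 0 < |r| + 1 := by positivity
    haveI : IsFiniteMeasure (volume.restrict (ball (0 : EuclideanSpace ℝ (Fin 3)) (|r| + 1))) :=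
      isFiniteMeasure_restrict.2 measure_ball_lt_top.ne
    have h32 : (1 : ℝ≥0∞) ≤ 3 / 2 := by
      rw [ENNReal.le_div_iff_mul_le (Or.inl two_ne_zero) (Or.inl ENNReal.ofNat_ne_top)]; norm_num
    have hI : IntegrableOn P (ball (0 : EuclideanSpace ℝ (Fin 3)) (|r| + 1)) volume :=
      (memLp_threeHalves_ball_of_weight hPm hBne hPw hr).integrable h32
    exact hI.mono_set (hKr.trans (closedBall_subset_ball (by linarith [le_abs_self r])))
  -- the weak Poisson equation of the profile
  have hPoisson := fun (θ : EuclideanSpace ℝ (Fin 3) → ℝ) (hθ : ContDiff ℝ (⊤ : ℕ∞) θ)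
      (hθc : HasCompactSupport θ) =>
    profile_pressure_poisson hsw hum hu hp hV2.locallyIntegrable hP1 hθ hθc
  -- growth bounds with `σ = 4/3`
  set AP : ℝ := (ENNReal.ofReal ((2 - 2 * (1 / 2 : ℝ)) / (2 + 1 / 2)) * (c : ℝ≥0∞)).toReal ^ (2 / 3 : ℝ) *
    (volume.real (ball (0 : EuclideanSpace ℝ (Fin 3)) 1)) ^ (1 / 3 : ℝ) with hAP
  set AV : ℝ := (∫ y in closedBall (0 : EuclideanSpace ℝ (Fin 3)) |R₀|, ‖V y‖ ^ 3) +
    Cup * ∫ z, ‖V z‖ ^ 2 with hAV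
  have hAP0 : 0 ≤ AP := by positivity
  have hPg : ∀ L : ℝ, 1 ≤ L → ∫ y in ball (0 : EuclideanSpace ℝ (Fin 3)) L, |P y| ≤
      max AP AV * L ^ (3 - (4 / 3 : ℝ)) := by
    intro L hL
    rw [show (3 : ℝ) - 4 / 3 = 5 / 3 by norm_num]
    exact (setIntegral_abs_le_of_weight hPm hBne hPw hL).trans
      (mul_le_mul_of_nonneg_right (le_max_left _ _) (by positivity))
  have hVg : ∀ L : ℝ, 1 ≤ L → ∫ y in ball (0 : EuclideanSpace ℝ (Fin 3)) L, ‖V y‖ ^ 3 ≤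
      max AP AV * L ^ (3 - (4 / 3 : ℝ)) := by
    intro L hL
    rw [show (3 : ℝ) - 4 / 3 = 5 / 3 by norm_num]
    exact (setIntegral_cube_le_of_sublinear hV2 hV3 hδ1 (by linarith) hCup hup hL).trans
      (mul_le_mul_of_nonneg_right (le_max_right _ _) (by positivity))
  -- the Riesz representation at every scale
  have hPR : ∀ R : ℝ, 1 ≤ R → ∀ᵐ y ∂volume, ‖y‖ < R / 2 →
      P y = rieszPressure ((ball (0 : EuclideanSpace ℝ (Fin 3)) R).indicator V) y +
        ∫ z in {z | R ≤ ‖z‖}, pressureKernel (y - z) (V z) :=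
    fun R hR => pressure_ae_eq_scaleQ_of_poisson hVm hV2 hV3 hP1 hPoisson (σ := 4 / 3)
      (by norm_num) (by norm_num) (le_max_of_le_left hAP0) hPg hVg (by linarith)
  exact shell_energy_decay_half hVm hV2 hV3 hPV
    (by norm_num : (1 / (2 + (1 / 2 : ℝ)) : ℝ) = 2 / 5) hLEI hPR hδ hδ1 hCup hup hε

end Drain

section ShellLower

/-- **No endpoint member with a sublinear profile whose shell energies are frequently
`≥ c₀ L^{−5+η}`.**  Crux hypotheses verbatim at `ρ = 1/2`, exact self-similarity, sublinear growth
`‖V(y)‖ ≤ C_up|y|^{1−δ}` a.e. far out, and: for some `c₀, η > 0` and radii `L` beyond every bound,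
`c₀ L^{−5+η} ≤ ∫_{L≤|y|<2L} ‖V‖²`.  Contradiction with the drain at `ε = η/2`
(`shell_energy_decay_of_sublinear`): `c₀ L^{η/2} ≤ C` along unbounded `L`.  Chae–Shvydkoy's Thm 3.1
(power spread) is the special case of a pointwise lower bound (`shellLower_of_powerLower`).
[cite: ChaeShvydkoy2013, §3.1 Thm. 3.1] -/
theorem selfSimilar_half_false_of_shellLower
    {u : ℝ → EuclideanSpace ℝ (Fin 3) → EuclideanSpace ℝ (Fin 3)}
    {p : ℝ → EuclideanSpace ℝ (Fin 3) → ℝ}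
    {H : ℝ → EuclideanSpace ℝ (Fin 3) → EuclideanSpace ℝ (Fin 3) →L[ℝ] EuclideanSpace ℝ (Fin 3)}
    {c : ℝ≥0} {V : EuclideanSpace ℝ (Fin 3) → EuclideanSpace ℝ (Fin 3)}
    {P : EuclideanSpace ℝ (Fin 3) → ℝ}
    (hsw : IsSuitableWeakSolutionOn (slab (EuclideanSpace ℝ (Fin 3)) (Iio 0) isOpen_Iio) 0 0 u p)
    (hH : HasWeakSpatialGradientOn (slab (EuclideanSpace ℝ (Fin 3)) (Iio 0) isOpen_Iio) u H)
    (hgauge : ∀ a : ℝ, 0 < a →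
      ENNReal.ofReal (a ^ (2 * (1 / 2 : ℝ))) * cknA a (0 : ℝ × EuclideanSpace ℝ (Fin 3)) u +
          ENNReal.ofReal (a ^ (1 / 2 : ℝ)) * cknE a (0 : ℝ × EuclideanSpace ℝ (Fin 3)) H +
        ENNReal.ofReal (a ^ (2 * (1 / 2 : ℝ))) * cknD a (0 : ℝ × EuclideanSpace ℝ (Fin 3)) p ≤
          (c : ℝ≥0∞))
    (hu : ∀ τ : ℝ, τ < 0 → u τ = selfSimilarCollapse (1 / (2 + (1 / 2 : ℝ))) 0 V τ)
    (hp : ∀ τ : ℝ, τ < 0 → p τ = selfSimilarCollapsePressure (1 / (2 + (1 / 2 : ℝ))) 0 P τ)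
    {δ Cup R₀ : ℝ} (hδ : 0 < δ) (hδ1 : δ ≤ 1) (hCup : 0 ≤ Cup)
    (hup : ∀ᵐ y ∂volume, R₀ ≤ ‖y‖ → ‖V y‖ ≤ Cup * ‖y‖ ^ (1 - δ))
    {c₀ η : ℝ} (hc₀ : 0 < c₀) (hη : 0 < η)
    (hlow : ∀ L₁ : ℝ, ∃ L : ℝ, L₁ ≤ L ∧
      c₀ * L ^ (-(5 : ℝ) + η) ≤
        ∫ y in {y : EuclideanSpace ℝ (Fin 3) | L ≤ ‖y‖ ∧ ‖y‖ < 2 * L}, ‖V y‖ ^ 2) : False := by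
  obtain ⟨C, hC⟩ := shell_energy_decay_of_sublinear hsw hH hgauge hu hp hδ hδ1 hCup hup
    (half_pos hη)
  -- `c₀ L^{η/2} ≤ C` along the unbounded radii
  have hkey : ∀ L : ℝ, 1 ≤ L →
      c₀ * L ^ (-(5 : ℝ) + η) ≤
        ∫ y in {y : EuclideanSpace ℝ (Fin 3) | L ≤ ‖y‖ ∧ ‖y‖ < 2 * L}, ‖V y‖ ^ 2 →
      c₀ * L ^ (η / 2) ≤ C := by
    intro L hL1 hL
    have hL0 : 0 < L := one_pos.trans_le hL1
    have h1 : c₀ * L ^ (-(5 : ℝ) + η) ≤ C * L ^ (-(5 : ℝ) + η / 2) := hL.trans (hC L hL1)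
    have h2 := mul_le_mul_of_nonneg_right h1 (Real.rpow_pos_of_pos hL0 (5 - η / 2)).le
    have e1 : c₀ * L ^ (-(5 : ℝ) + η) * L ^ (5 - η / 2) = c₀ * L ^ (η / 2) := by
      rw [mul_assoc, ← Real.rpow_add hL0]; ring_nf
    have e2 : C * L ^ (-(5 : ℝ) + η / 2) * L ^ (5 - η / 2) = C := by
      rw [mul_assoc, ← Real.rpow_add hL0, show -(5 : ℝ) + η / 2 + (5 - η / 2) = 0 by ring,
        Real.rpow_zero, mul_one]
    rwa [e1, e2] at h2
  -- choose a radius beyond `max 1 ((C/c₀ + 1)^{2/η})` where `L^{η/2} > C/c₀`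
  have hev : ∀ᶠ L : ℝ in atTop, C / c₀ < L ^ (η / 2) :=
    (tendsto_rpow_atTop (half_pos hη)).eventually_gt_atTop (C / c₀)
  obtain ⟨L₁, hL₁⟩ := (hev.and (eventually_ge_atTop (1 : ℝ))).exists_forall_of_atTop
  obtain ⟨L, hLL₁, hL⟩ := hlow L₁
  have h := hkey L (hL₁ L hLL₁).2 hL
  have h' := (hL₁ L hLL₁).1
  rw [div_lt_iff₀ hc₀] at h'
  linarith [mul_comm c₀ (L ^ (η / 2))]

/-- **The shell-lower stratum of rung C1 at the endpoint, `Sig`-shaped**: an exactly self-similar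
member of the class at `ρ = 1/2` with a sublinear profile whose dyadic shell energies are
`≥ c₀ L^{−5+η}` along radii beyond every bound vanishes a.e. (vacuously). [cite: ChaeShvydkoy2013, §3.1 Thm. 3.1] -/
theorem selfSimilar_half_ae_eq_zero_of_shellLower
    {u : ℝ → EuclideanSpace ℝ (Fin 3) → EuclideanSpace ℝ (Fin 3)}
    {p : ℝ → EuclideanSpace ℝ (Fin 3) → ℝ}
    {H : ℝ → EuclideanSpace ℝ (Fin 3) → EuclideanSpace ℝ (Fin 3) →L[ℝ] EuclideanSpace ℝ (Fin 3)}
    {c : ℝ≥0} {V : EuclideanSpace ℝ (Fin 3) → EuclideanSpace ℝ (Fin 3)}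
    {P : EuclideanSpace ℝ (Fin 3) → ℝ}
    (hsw : IsSuitableWeakSolutionOn (slab (EuclideanSpace ℝ (Fin 3)) (Iio 0) isOpen_Iio) 0 0 u p)
    (hH : HasWeakSpatialGradientOn (slab (EuclideanSpace ℝ (Fin 3)) (Iio 0) isOpen_Iio) u H)
    (hgauge : ∀ a : ℝ, 0 < a →
      ENNReal.ofReal (a ^ (2 * (1 / 2 : ℝ))) * cknA a (0 : ℝ × EuclideanSpace ℝ (Fin 3)) u +
          ENNReal.ofReal (a ^ (1 / 2 : ℝ)) * cknE a (0 : ℝ × EuclideanSpace ℝ (Fin 3)) H +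
        ENNReal.ofReal (a ^ (2 * (1 / 2 : ℝ))) * cknD a (0 : ℝ × EuclideanSpace ℝ (Fin 3)) p ≤
          (c : ℝ≥0∞))
    (hu : ∀ τ : ℝ, τ < 0 → u τ = selfSimilarCollapse (1 / (2 + (1 / 2 : ℝ))) 0 V τ)
    (hp : ∀ τ : ℝ, τ < 0 → p τ = selfSimilarCollapsePressure (1 / (2 + (1 / 2 : ℝ))) 0 P τ)
    {δ Cup R₀ : ℝ} (hδ : 0 < δ) (hδ1 : δ ≤ 1) (hCup : 0 ≤ Cup)
    (hup : ∀ᵐ y ∂volume, R₀ ≤ ‖y‖ → ‖V y‖ ≤ Cup * ‖y‖ ^ (1 - δ))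
    {c₀ η : ℝ} (hc₀ : 0 < c₀) (hη : 0 < η)
    (hlow : ∀ L₁ : ℝ, ∃ L : ℝ, L₁ ≤ L ∧
      c₀ * L ^ (-(5 : ℝ) + η) ≤
        ∫ y in {y : EuclideanSpace ℝ (Fin 3) | L ≤ ‖y‖ ∧ ‖y‖ < 2 * L}, ‖V y‖ ^ 2) :
    uncurry u =ᵐ[volume.restrict (Iio (0 : ℝ) ×ˢ (univ : Set (EuclideanSpace ℝ (Fin 3))))] 0 :=
  (selfSimilar_half_false_of_shellLower hsw hH hgauge hu hp hδ hδ1 hCup hup hc₀ hη hlow).elim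

/-- **A pointwise lower power bound gives the shell lower bound at every large radius** (so the
shell-lower stratum contains the power-spread stratum): if `‖V‖² ∈ L¹` and
`c₀|y|^{−(4−δ')} ≤ ‖V(y)‖` a.e. on `|y| ≥ R₀'` (`c₀, δ' > 0`), then with `η = 2 min(δ', 4)` and an
explicit `c₁ > 0`, `c₁ L^{−5+η} ≤ ∫_{L≤|y|<2L}‖V‖²` for every `L ≥ max R₀' 1`
(`shell_energy_lower_of_powerLower`). [cite: ChaeShvydkoy2013, §3.1 proof of Thm. 3.1] -/
theorem shellLower_of_powerLower {V : EuclideanSpace ℝ (Fin 3) → EuclideanSpace ℝ (Fin 3)}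
    (hV2 : Integrable (fun z => ‖V z‖ ^ 2) volume)
    {c₀ δ' R₀' : ℝ} (hc₀ : 0 < c₀) (hδ' : 0 < δ')
    (hlow : ∀ᵐ y ∂volume, R₀' ≤ ‖y‖ → c₀ * ‖y‖ ^ (-(4 - δ')) ≤ ‖V y‖) :
    ∃ c₁ η : ℝ, 0 < c₁ ∧ 0 < η ∧ ∀ L : ℝ, max R₀' 1 ≤ L →
      c₁ * L ^ (-(5 : ℝ) + η) ≤
        ∫ y in {y : EuclideanSpace ℝ (Fin 3) | L ≤ ‖y‖ ∧ ‖y‖ < 2 * L}, ‖V y‖ ^ 2 := by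
  -- WLOG `δ' ≤ 4`
  set δ₀ : ℝ := min δ' 4 with hδ₀
  have hδ₀0 : 0 < δ₀ := lt_min hδ' (by norm_num)
  have hδ₀4 : δ₀ ≤ 4 := min_le_right _ _
  have hlow' : ∀ᵐ y ∂volume, max R₀' 1 ≤ ‖y‖ → c₀ * ‖y‖ ^ (-(4 - δ₀)) ≤ ‖V y‖ := by
    filter_upwards [hlow] with y hy hyR
    have hy1 : 1 ≤ ‖y‖ := (le_max_right _ _).trans hyR
    refine le_trans (mul_le_mul_of_nonneg_left ?_ hc₀.le) (hy ((le_max_left _ _).trans hyR))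
    exact Real.rpow_le_rpow_of_exponent_le hy1 (by linarith [min_le_left δ' 4])
  have hv : 0 < volume.real (ball (0 : EuclideanSpace ℝ (Fin 3)) 1) :=
    ENNReal.toReal_pos (measure_ball_pos _ _ one_pos).ne' measure_ball_lt_top.ne
  refine ⟨c₀ ^ 2 * (2 : ℝ) ^ (-(8 - 2 * δ₀)) * (1 / 4) ^ 3 *
    volume.real (ball (0 : EuclideanSpace ℝ (Fin 3)) 1), 2 * δ₀, by positivity, by linarith, ?_⟩
  intro L hL
  have h := shell_energy_lower_of_powerLower hV2 hc₀ hδ₀4 hlow' (le_of_eq_of_le (by simp) hL)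
  simpa using h

end ShellLower

end EndpointSpread

end Summit.NavierStokesRegularity.NavierStokesRegularity.Theorems.PowerGaugeEulerLiouville

end
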